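import Summits.NavierStokesRegularity.NavierStokesRegularity.Theorems.ExtremiserTransienceZoomCompactness
import Summits.NavierStokesRegularity.NavierStokesRegularity.Theorems.ExtremiserTransienceWeakClassTypeIAncientMild
import Summits.NavierStokesRegularity.NavierStokesRegularity.Theorems.ExtremiserTransiencePerFlowScaleLockOfEnstrophyRate
import Literature.Analysis.FluidPDE.TypeIAncientMild
import HarnessLib

/-!
# Route `ExtremiserTransience`, crux `NearExtremalTransiencePerFlow` (stmt-NavierStokesRegularity-26567),
# LINE g7-δ «coherent member selection», stub T2 `stub_zoomPackage` — part 1: ZOOM COMPACTNESS OF THE SLICE FAMILY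

`--supports stmt-NavierStokesRegularity-26567` (helper; LINE δ = `Cruxes/NearExtremalTransiencePerFlow/Lines/member_selection.lean`,
PASS idea-crit-4 2026-08-28; its stubs are not the registered skeleton of record, so this lands as a helper). Author: prover seat `ns-net-p2` (g0).

T2 asks, for a Type-I singular classical Leray–Hopf flow `u` on `[0,T)` and late times `t n → T` with height bounds
`‖u (t n)‖ ≤ Mb n`, that the NS-compatible zoomed slices `v n y = (Mb n)⁻¹ • u (t n) ((ν / Mb n) • y)` be (i) a near-extremal
height-1 family and (ii) ZOOM-COMPACT: along any centres `y n` and any subsequence, a further subsequence of the translates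
`v n (y n + ·)` converges pointwise to a slice `W s`, `s < 0`, of a Type-I ancient mild field.  This file proves (ii)
(`zoomCompact_sliceFamily`, δ's `ZoomCompact` UNFOLDED) from the landed KNSS compactness of moving-centre zooms
(`ExtremiserTransience.zoomCompactnessKNSS`, KNSS 2009 Lemma 6.1) and the landed identification of the weak one-slice class with
`IsTypeIAncientMild` (`weakClass_isTypeIAncientMild`), by placing the slice `u (t n)` at the FIXED negative zoom time
`s₀ = −c₀²/2` of the zoom with vertex `τ n = t n + ν(c₀²/2)/(Mb n)²` — legitimate (`τ n < T`) by Leray's lower blow-up rate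
`c₀√ν ≤ √(T−t)·‖u(t,x)‖` (`PerFlow.lerayLowerRate_of_not_extends`), which also gives `Mb n ≥ c₀√ν/√(T − t n) → ∞`; the uniform
bounds of the zooms come from the eventual Type-I rate near `T` and the slab bound `exists_forall_norm_le_of_tao2011` before it.
HONEST FRAMING: a compactness statement about hypothetical Type-I singular flows; nothing about Navier–Stokes regularity or blow-up
is proved; no summit is proved by a line. [cite: KochNadirashviliSereginSverak2009, Lemma 6.1 (arXiv:0709.3599 p. 11)]
-/

noncomputable section

open scoped Topology
open Filter Set MeasureTheory Function Metric
open Literature.Analysis Literature.Analysis.FluidPDE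

namespace Summit.NavierStokesRegularity.NavierStokesRegularity.Theorems.ExtremiserTransience

-- the problem directory repeats the summit name (`NavierStokesRegularity/NavierStokesRegularity`)
set_option linter.dupNamespace false

/-- **Zoom compactness of the slice family (δ's `ZoomCompact`, unfolded).**  For a classical Leray–Hopf flow on `[0,T)` from
rapidly decaying data with an eventual Type-I rate and no smooth extension past `T`, late times `t n → T` and height bounds
`‖u (t n) ·‖ ≤ Mb n`: along any centres `y n` and any subsequence `φ`, a further subsequence of
`z ↦ (Mb n)⁻¹ • u (t n) ((ν / Mb n) • (y n + z))` converges pointwise to `W s` for some Type-I ancient mild `W` and `s < 0`.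
[cite: KochNadirashviliSereginSverak2009, Lemma 6.1 (arXiv:0709.3599 p. 11)] -/
theorem zoomCompact_sliceFamily {C ν T : ℝ} {u : ℝ → EuclideanSpace ℝ (Fin 3) → EuclideanSpace ℝ (Fin 3)}
    {p : ℝ → EuclideanSpace ℝ (Fin 3) → ℝ} (hν : 0 < ν) (hT : 0 < T)
    (hsol : IsClassicalNSSolutionOn (Set.Ico 0 T) ν 0 u p) (hLH : IsLerayHopfOn T ν 0 (u 0) u)
    (hdec : HasRapidSpatialDecay (u 0)) (hrate : ∀ᶠ t in 𝓝[<] T, ∀ x, Real.sqrt (T - t) * ‖u t x‖ ≤ C * Real.sqrt ν)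
    (hext : ¬ HasSmoothExtensionPast ν 0 u T) {t Mb : ℕ → ℝ} (ht : ∀ n, t n ∈ Set.Ico 0 T)
    (htT : Tendsto t atTop (𝓝 T)) (hMb : ∀ n x, ‖u (t n) x‖ ≤ Mb n) :
    ∀ (y : ℕ → EuclideanSpace ℝ (Fin 3)) (φ : ℕ → ℕ), StrictMono φ →
      ∃ (ψ : ℕ → ℕ) (K s : ℝ) (W : ℝ → EuclideanSpace ℝ (Fin 3) → EuclideanSpace ℝ (Fin 3)), StrictMono ψ ∧
        Literature.Analysis.FluidPDE.IsTypeIAncientMild K W ∧ s < 0 ∧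
        ∀ z, Tendsto (fun n => (Mb (φ (ψ n)))⁻¹ • u (t (φ (ψ n))) ((ν / Mb (φ (ψ n))) • (y (φ (ψ n)) + z)))
          atTop (𝓝 (W s z)) := by
  intro y φ hφ
  have hsν : 0 < Real.sqrt ν := Real.sqrt_pos.2 hν
  have hTt : ∀ n, 0 < T - t n := fun n => sub_pos.2 (ht n).2
  -- Leray's lower rate: `c₀ √ν ≤ √(T − t) ‖u t x‖` for some `x`, hence `c₀ √ν ≤ √(T − t n) · Mb n`
  obtain ⟨c₀, hc₀, hler⟩ := DepletionLadder.PerFlow.lerayLowerRate_of_not_extends hν hT hsol hLH hdec hext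
  have hMbL : ∀ n, c₀ * Real.sqrt ν ≤ Real.sqrt (T - t n) * Mb n := fun n => by
    obtain ⟨x, hx⟩ := hler (t n) (ht n)
    exact hx.trans (mul_le_mul_of_nonneg_left (hMb n x) (Real.sqrt_nonneg _))
  have hMbpos : ∀ n, 0 < Mb n := fun n => by
    by_contra h
    have h1 : Real.sqrt (T - t n) * Mb n ≤ 0 := mul_nonpos_of_nonneg_of_nonpos (Real.sqrt_nonneg _) (not_lt.1 h)
    have h2 : 0 < c₀ * Real.sqrt ν := mul_pos hc₀ hsν
    linarith [hMbL n]
  -- squared form: `ν c₀² ≤ (T − t n) · (Mb n)²`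
  have hsq : ∀ n, ν * c₀ ^ 2 ≤ (T - t n) * Mb n ^ 2 := fun n => by
    have h := pow_le_pow_left₀ (by positivity) (hMbL n) 2
    rw [mul_pow, mul_pow, Real.sq_sqrt hν.le, Real.sq_sqrt (hTt n).le] at h
    linarith
  -- `√ν / √(T − t n) ≤ Mb n / c₀`
  have hratio : ∀ n, Real.sqrt ν / Real.sqrt (T - t n) ≤ Mb n / c₀ := fun n => by
    rw [div_le_div_iff₀ (Real.sqrt_pos.2 (hTt n)) hc₀]
    calc Real.sqrt ν * c₀ = c₀ * Real.sqrt ν := mul_comm _ _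
      _ ≤ Real.sqrt (T - t n) * Mb n := hMbL n
      _ = Mb n * Real.sqrt (T - t n) := mul_comm _ _
  -- the eventual Type-I rate holds on `(t⋆, T)`; slab bound `U` on `[0, T₁]`, `T₁ = max ((t⋆+T)/2) (T/2)`
  obtain ⟨tstar, htstar, hsub⟩ := mem_nhdsLT_iff_exists_Ioo_subset.1 hrate
  have htstarT : tstar < T := htstar
  set T₁ : ℝ := max ((tstar + T) / 2) (T / 2) with hT₁def
  have hT₁T : T₁ < T := max_lt (by linarith [htstarT]) (by linarith)
  have hT₁0 : 0 < T₁ := lt_of_lt_of_le (by linarith) (le_max_right _ _)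
  have hT₁star : tstar < T₁ := lt_of_lt_of_le (by linarith [htstarT]) (le_max_left _ _)
  obtain ⟨U, hU⟩ := exists_forall_norm_le_of_tao2011 tao2011_hasBoundedSobolevNormsOn_holds hν hsol hLH hdec T₁ ⟨hT₁0, hT₁T⟩
  have hU0 : 0 ≤ U := (norm_nonneg _).trans (hU 0 ⟨le_rfl, hT₁0.le⟩ 0)
  have htypeI : ∀ t' : ℝ, T₁ < t' → t' < T → ∀ x, ‖u t' x‖ ≤ C * Real.sqrt ν / Real.sqrt (T - t') := by
    intro t' h1 h2 x
    have h := hsub ⟨hT₁star.trans h1, h2⟩ x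
    rw [le_div_iff₀ (Real.sqrt_pos.2 (sub_pos.2 h2)), mul_comm]
    exact h
  have hC0 : 0 ≤ C := by
    have h := hsub (a := (T₁ + T) / 2) ⟨by linarith, by linarith⟩ 0
    have h1 : 0 ≤ Real.sqrt (T - (T₁ + T) / 2) * ‖u ((T₁ + T) / 2) 0‖ := by positivity
    nlinarith
  -- the zoom data: fixed zoom time `s₀ = −c₀²/2`, vertices `τ n`, centres `x n`
  set s₀ : ℝ := -(c₀ ^ 2 / 2) with hs₀def
  have hs₀ : s₀ < 0 := by rw [hs₀def]; exact neg_neg_of_pos (by positivity)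
  set τ : ℕ → ℝ := fun n => t n - ν * s₀ / Mb n ^ 2 with hτdef
  set x : ℕ → EuclideanSpace ℝ (Fin 3) := fun n => (ν / Mb n) • y n with hxdef
  have hτt : ∀ n, τ n + ν * s₀ / Mb n ^ 2 = t n := fun n => by simp only [hτdef]; ring
  have hτge : ∀ n, t n < τ n := fun n => by
    have : 0 < ν * (c₀ ^ 2 / 2) / Mb n ^ 2 := by have := hMbpos n; positivity
    simp only [hτdef, hs₀def]
    rw [show ν * -(c₀ ^ 2 / 2) / Mb n ^ 2 = -(ν * (c₀ ^ 2 / 2) / Mb n ^ 2) by ring]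
    linarith
  have hτpos : ∀ n, 0 < τ n := fun n => lt_of_le_of_lt (ht n).1 (hτge n)
  -- `T − τ n ≥ (T − t n)/2`, in particular `τ n < T`
  have hTτ : ∀ n, (T - t n) / 2 ≤ T - τ n := fun n => by
    have hM2 : 0 < Mb n ^ 2 := pow_pos (hMbpos n) 2
    have h1 : ν * (c₀ ^ 2 / 2) / Mb n ^ 2 ≤ (T - t n) / 2 := by
      rw [div_le_iff₀ hM2]; nlinarith [hsq n]
    simp only [hτdef, hs₀def]
    rw [show ν * -(c₀ ^ 2 / 2) / Mb n ^ 2 = -(ν * (c₀ ^ 2 / 2) / Mb n ^ 2) by ring]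
    linarith
  have hτT : ∀ n, τ n < T := fun n => by linarith [hTτ n, hTt n]
  -- the uniform constants
  set N : ℝ := max (C * Real.sqrt 2 / c₀) (U * Real.sqrt T / (c₀ * Real.sqrt ν)) with hNdef
  have hN0 : 0 ≤ N := le_trans (by positivity) (le_max_left _ _)
  set K : ℝ := max C (U * Real.sqrt T / Real.sqrt ν) with hKdef
  -- the two bounds used repeatedly
  have hUMb : ∀ n, U ≤ U * Real.sqrt T / (c₀ * Real.sqrt ν) * Mb n := fun n => by
    have h1 : c₀ * Real.sqrt ν ≤ Real.sqrt T * Mb n :=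
      (hMbL n).trans (mul_le_mul_of_nonneg_right (Real.sqrt_le_sqrt (by linarith [(ht n).1])) (hMbpos n).le)
    have h2 : 1 ≤ Real.sqrt T / (c₀ * Real.sqrt ν) * Mb n := by
      rw [div_mul_eq_mul_div, le_div_iff₀ (by positivity), one_mul]; exact h1
    calc U = U * 1 := (mul_one U).symm
      _ ≤ U * (Real.sqrt T / (c₀ * Real.sqrt ν) * Mb n) := mul_le_mul_of_nonneg_left h2 hU0
      _ = U * Real.sqrt T / (c₀ * Real.sqrt ν) * Mb n := by ring
  have hbound : ∀ n, ∀ t' ∈ Set.Ioo 0 (τ n), ∀ z, ‖u t' z‖ ≤ N * Mb n := by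
    intro n t' ht' z
    rcases le_or_gt t' T₁ with h1 | h1
    · calc ‖u t' z‖ ≤ U := hU t' ⟨ht'.1.le, h1⟩ z
        _ ≤ U * Real.sqrt T / (c₀ * Real.sqrt ν) * Mb n := hUMb n
        _ ≤ N * Mb n := mul_le_mul_of_nonneg_right (le_max_right _ _) (hMbpos n).le
    · have ht'T : t' < T := ht'.2.trans (hτT n)
      have hTt' : (T - t n) / 2 ≤ T - t' := (hTτ n).trans (by linarith [ht'.2])
      calc ‖u t' z‖ ≤ C * Real.sqrt ν / Real.sqrt (T - t') := htypeI t' h1 ht'T z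
        _ ≤ C * Real.sqrt ν / Real.sqrt ((T - t n) / 2) :=
            div_le_div_of_nonneg_left (mul_nonneg hC0 hsν.le) (Real.sqrt_pos.2 (by linarith [hTt n]))
              (Real.sqrt_le_sqrt hTt')
        _ = C * Real.sqrt 2 * (Real.sqrt ν / Real.sqrt (T - t n)) := by
            rw [Real.sqrt_div' _ (by norm_num : (0 : ℝ) ≤ 2)]
            field_simp
        _ ≤ C * Real.sqrt 2 * (Mb n / c₀) := mul_le_mul_of_nonneg_left (hratio n) (by positivity)
        _ = C * Real.sqrt 2 / c₀ * Mb n := by ring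
        _ ≤ N * Mb n := mul_le_mul_of_nonneg_right (le_max_left _ _) (hMbpos n).le
  have hzoomI : ∀ n, ∀ s : ℝ, -(τ n * Mb n ^ 2 / ν) < s → s < 0 → ∀ z,
      Real.sqrt (-s) * ‖(Mb n)⁻¹ • u (τ n + ν * s / Mb n ^ 2) (x n + (ν / Mb n) • z)‖ ≤ K := by
    intro n s hs1 hs2 z
    have hM := hMbpos n
    have hM2 : 0 < Mb n ^ 2 := pow_pos hM 2
    set t' : ℝ := τ n + ν * s / Mb n ^ 2 with ht'def
    have ht'pos : 0 < t' := by
      have : -(τ n) < ν * s / Mb n ^ 2 := by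
        rw [lt_div_iff₀ hM2]
        have := mul_lt_mul_of_pos_left hs1 hν
        have e : ν * -(τ n * Mb n ^ 2 / ν) = -(τ n) * Mb n ^ 2 := by field_simp
        linarith [e ▸ this]
      simp only [ht'def]; linarith
    have ht'τ : t' < τ n := by
      have : ν * s / Mb n ^ 2 < 0 := div_neg_of_neg_of_pos (mul_neg_of_pos_of_neg hν hs2) hM2
      simp only [ht'def]; linarith
    have hns : 0 < -s := by linarith
    rw [norm_smul, norm_inv, Real.norm_eq_abs, abs_of_pos hM]
    rcases le_or_gt t' T₁ with h1 | h1
    · -- early time: slab bound and `√(−s) ≤ Mb n √T / √ν`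
      have hsT : -s ≤ T * Mb n ^ 2 / ν := by
        have e : -s = (τ n - t') * Mb n ^ 2 / ν := by simp only [ht'def]; field_simp; ring
        rw [e]
        gcongr
        linarith [hτT n]
      have hsqrt : Real.sqrt (-s) ≤ Mb n * Real.sqrt T / Real.sqrt ν := by
        calc Real.sqrt (-s) ≤ Real.sqrt (T * Mb n ^ 2 / ν) := Real.sqrt_le_sqrt hsT
          _ = Mb n * Real.sqrt T / Real.sqrt ν := by
              rw [Real.sqrt_div' _ hν.le, Real.sqrt_mul hT.le, Real.sqrt_sq hM.le]; ring
      calc Real.sqrt (-s) * ((Mb n)⁻¹ * ‖u t' (x n + (ν / Mb n) • z)‖)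
          ≤ (Mb n * Real.sqrt T / Real.sqrt ν) * ((Mb n)⁻¹ * U) := by
            gcongr
            exact hU t' ⟨ht'pos.le, h1⟩ _
        _ = U * Real.sqrt T / Real.sqrt ν := by field_simp
        _ ≤ K := le_max_right _ _
    · -- late time: Type-I and `T − t' ≥ ν(−s)/(Mb n)²`
      have ht'T : t' < T := ht'τ.trans (hτT n)
      have hTt' : ν * (-s) / Mb n ^ 2 ≤ T - t' := by
        have e : T - t' = (T - τ n) + ν * (-s) / Mb n ^ 2 := by simp only [ht'def]; ring
        rw [e]; linarith [hτT n]
      have hsqrt : Real.sqrt ν * Real.sqrt (-s) / Mb n ≤ Real.sqrt (T - t') := by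
        calc Real.sqrt ν * Real.sqrt (-s) / Mb n = Real.sqrt (ν * (-s) / Mb n ^ 2) := by
              rw [Real.sqrt_div' _ hM2.le, Real.sqrt_mul hν.le, Real.sqrt_sq hM.le]
          _ ≤ Real.sqrt (T - t') := Real.sqrt_le_sqrt hTt'
      have hpos : 0 < Real.sqrt ν * Real.sqrt (-s) / Mb n := by positivity
      have h2 : 0 ≤ (Mb n)⁻¹ := by positivity
      have h3 : 0 ≤ Real.sqrt (-s) := Real.sqrt_nonneg _
      have hstep : C * Real.sqrt ν / Real.sqrt (T - t') ≤ C * Real.sqrt ν / (Real.sqrt ν * Real.sqrt (-s) / Mb n) :=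
        div_le_div_of_nonneg_left (mul_nonneg hC0 hsν.le) hpos hsqrt
      calc Real.sqrt (-s) * ((Mb n)⁻¹ * ‖u t' (x n + (ν / Mb n) • z)‖)
          ≤ Real.sqrt (-s) * ((Mb n)⁻¹ * (C * Real.sqrt ν / Real.sqrt (T - t'))) :=
            mul_le_mul_of_nonneg_left (mul_le_mul_of_nonneg_left (htypeI t' h1 ht'T _) h2) h3
        _ ≤ Real.sqrt (-s) * ((Mb n)⁻¹ * (C * Real.sqrt ν / (Real.sqrt ν * Real.sqrt (-s) / Mb n))) :=
            mul_le_mul_of_nonneg_left (mul_le_mul_of_nonneg_left hstep h2) h3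
        _ = C := by field_simp
        _ ≤ K := le_max_left _ _
  -- the windows grow: `τ (φ n) (Mb (φ n))² / ν → ∞`
  have hlim : Tendsto (fun n => τ (φ n) * Mb (φ n) ^ 2 / ν) atTop atTop := by
    have hφT : Tendsto (fun n => t (φ n)) atTop (𝓝 T) := htT.comp hφ.tendsto_atTop
    have hgap : Tendsto (fun n => T - t (φ n)) atTop (𝓝[>] 0) := by
      refine tendsto_nhdsWithin_iff.2 ⟨?_, Eventually.of_forall fun n => hTt (φ n)⟩
      have h : Tendsto (fun n => T - t (φ n)) atTop (𝓝 (T - T)) :=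
        (tendsto_const_nhds (x := T)).sub hφT
      rwa [sub_self] at h
    have hinv : Tendsto (fun n => (T * c₀ ^ 2 / 2) * (T - t (φ n))⁻¹) atTop atTop :=
      (tendsto_inv_nhdsGT_zero.comp hgap).const_mul_atTop (by positivity)
    refine tendsto_atTop_mono' atTop ?_ hinv
    have hev : ∀ᶠ n in atTop, T / 2 ≤ t (φ n) := by
      have : ∀ᶠ n in atTop, t (φ n) ∈ Set.Ioi (T / 2) := hφT (Ioi_mem_nhds (by linarith))
      exact this.mono fun n hn => le_of_lt hn
    filter_upwards [hev] with n hn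
    have hM2 : 0 < Mb (φ n) ^ 2 := pow_pos (hMbpos (φ n)) 2
    have hgap' : 0 < T - t (φ n) := hTt (φ n)
    have hnum : (T / 2) * (ν * c₀ ^ 2) ≤ t (φ n) * ((T - t (φ n)) * Mb (φ n) ^ 2) :=
      mul_le_mul hn (hsq (φ n)) (by positivity) (ht (φ n)).1
    calc T * c₀ ^ 2 / 2 * (T - t (φ n))⁻¹ = (T / 2) * (ν * c₀ ^ 2) / ((T - t (φ n)) * ν) := by
          field_simp
      _ ≤ t (φ n) * ((T - t (φ n)) * Mb (φ n) ^ 2) / ((T - t (φ n)) * ν) :=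
          div_le_div_of_nonneg_right hnum (by positivity)
      _ = t (φ n) * Mb (φ n) ^ 2 / ν := by field_simp
      _ ≤ τ (φ n) * Mb (φ n) ^ 2 / ν := by
          gcongr
          exact (hτge (φ n)).le
  -- KNSS compactness of the moving-centre zooms along `φ`
  obtain ⟨W, ψ, hψ, ⟨hcont, hmild, hdecW⟩, hconv⟩ :=
    zoomCompactnessKNSS ν T u p hν hT hsol hLH hdec (x ∘ φ) (τ ∘ φ) (Mb ∘ φ) N K hN0
      (fun n => ⟨hτpos (φ n), hτT (φ n), hMbpos (φ n), hbound (φ n), hzoomI (φ n)⟩) hlim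
  refine ⟨ψ, K, s₀, W, hψ, weakClass_isTypeIAncientMild W K hcont hmild hdecW, hs₀, fun z => ?_⟩
  have h := (tendstoLocallyUniformlyOn_univ.2 (hconv s₀ hs₀)).tendsto_at (Set.mem_univ z)
  refine h.congr fun n => ?_
  simp only [Function.comp_apply]
  rw [hτt (φ (ψ n)), hxdef, smul_add]

end Summit.NavierStokesRegularity.NavierStokesRegularity.Theorems.ExtremiserTransience

end
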